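import Literature.NumberTheory.Automorphic.CongruenceSubgroupPropertySL2SymbolMul
import Mathlib.Combinatorics.Additive.CauchyDavenport
import HarnessLib

/-!
# Serre's congruence subgroup property for `SL₂(𝓞_F)` — proofs, XVII: Liehl's (11), general case

Topic `Literature/NumberTheory/Automorphic`; namespace `Literature.NumberTheory.Automorphic.SL2Rel`.
Everything here is PROVED; no definitions.

**Liehl (11)**, general case (p. 160): *"Let `b₁b₂ ≠ 0`, `a ≠ 1`.  By (3) it is possible to choose
`y ∈ (a - 1)B` such that `(a + b₁b₂y)B` is a maximal ideal and the number of elements in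
`B/(a + b₁b₂y)B` is different from three.  Then in this finite field for any nonzero `b̄₁`, `b̄₂` the
equation `b̄₁u² + b̄₂v² = w²` is solvable with nonzero `u` and `v`, so that by Case 3
`[b₁][b₂] = [b₁b₂]` over `a + yb₁b₂`; but since `y ∈ I₂`, this completes the proof according to
(6)."*  Here: the prime `a' = a + b₁b₂y` of prime norm `p ∉ {2, 3}` comes from the tree's
`SerreSL2.exists_prime_mul_eq_span_singleton` ((3) = primes in arithmetic progressions); the conic
over `𝔽_p`, `p ≥ 5`, is solved with `u, v ≠ 0` by Cauchy–Davenport (`exists_conic_sol`); the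
degenerate cases (`a` a unit, which covers `b₁b₂ = 0` and `a = 1`; `a = 0`) are direct.
Main result: `SL2Rel.sym_mul_sym`.

## References

* [Liehl1981SL2Orders] B. Liehl, J. reine angew. Math. 323 (1981) 153–171, §3 (3), (11).
-/

open Matrix MatrixGroups NumberField IsDedekindDomain
open scoped Pointwise

namespace Literature.NumberTheory.Automorphic

namespace SL2Rel

/-! ### The conic `b₁u² + b₂v² = w²` over `𝔽_p`, `p ≥ 5` -/

section Conic

/-- `u ↦ bu²` is at most two-to-one on a field. [folklore] -/
private theorem card_filter_mul_sq_le {F : Type*} [Field F] [DecidableEq F] (s : Finset F) (b c : F)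
    (hb : b ≠ 0) : (s.filter fun u ↦ b * u ^ 2 = c).card ≤ 2 := by
  by_cases h : (s.filter fun u ↦ b * u ^ 2 = c).Nonempty
  · obtain ⟨u₀, hu₀⟩ := h
    rw [Finset.mem_filter] at hu₀
    refine (Finset.card_le_card (t := {u₀, -u₀}) fun u hu ↦ ?_).trans (Finset.card_le_two)
    rw [Finset.mem_filter] at hu
    have : u ^ 2 = u₀ ^ 2 := mul_left_cancel₀ hb (hu.2.trans hu₀.2.symm)
    rcases sq_eq_sq_iff_eq_or_eq_neg.1 this with h | h <;> simp [h]
  · rw [Finset.not_nonempty_iff_eq_empty.1 h]; simp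

/-- Lower bound for the image of `u ↦ bu²`. [folklore] -/
private theorem card_le_two_mul_card_image {F : Type*} [Field F] [DecidableEq F] (s : Finset F)
    (b : F) (hb : b ≠ 0) : s.card ≤ 2 * (s.image fun u ↦ b * u ^ 2).card :=
  Finset.card_le_mul_card_image s 2 fun c _ ↦ card_filter_mul_sq_le s b c hb

/-- **The conic over `𝔽_p`**: for a prime `p ≥ 5` and `b₁, b₂ ≠ 0` in `𝔽_p` there are `u, v ≠ 0`
and `w` with `b₁u² + b₂v² = w²` (Cauchy–Davenport: `|{b₁u²}| , |{b₂v²}| ≥ (p-1)/2`, so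
`|{b₁u² + b₂v² : uv ≠ 0}| ≥ p - 2 > p - |{w²}|`). [cite: Liehl1981SL2Orders, §3 (11) (general case)] -/
theorem exists_conic_sol {p : ℕ} (hp : p.Prime) (h5 : 5 ≤ p) {b₁ b₂ : ZMod p} (hb₁ : b₁ ≠ 0)
    (hb₂ : b₂ ≠ 0) : ∃ u v w : ZMod p, u ≠ 0 ∧ v ≠ 0 ∧ b₁ * u ^ 2 + b₂ * v ^ 2 = w ^ 2 := by
  classical
  haveI : Fact p.Prime := ⟨hp⟩
  set S₀ : Finset (ZMod p) := Finset.univ.erase 0 with hS₀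
  set s : Finset (ZMod p) := S₀.image fun u ↦ b₁ * u ^ 2 with hs
  set t : Finset (ZMod p) := S₀.image fun v ↦ b₂ * v ^ 2 with ht
  set sq : Finset (ZMod p) := Finset.univ.image fun w ↦ (1 : ZMod p) * w ^ 2 with hsq
  have hcard : Fintype.card (ZMod p) = p := ZMod.card p
  have hS₀card : S₀.card = p - 1 := by
    rw [hS₀, Finset.card_erase_of_mem (Finset.mem_univ _), Finset.card_univ, hcard]
  have hS₀ne : S₀.Nonempty := ⟨1, by rw [hS₀]; exact Finset.mem_erase.2 ⟨one_ne_zero, Finset.mem_univ _⟩⟩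
  have hs2 : p - 1 ≤ 2 * s.card := hS₀card ▸ card_le_two_mul_card_image S₀ b₁ hb₁
  have ht2 : p - 1 ≤ 2 * t.card := hS₀card ▸ card_le_two_mul_card_image S₀ b₂ hb₂
  have hsq2 : p ≤ 2 * sq.card := by
    have := card_le_two_mul_card_image (Finset.univ : Finset (ZMod p)) 1 one_ne_zero
    rwa [Finset.card_univ, hcard] at this
  have hsne : s.Nonempty := hS₀ne.image _
  have htne : t.Nonempty := hS₀ne.image _
  have hCD := ZMod.cauchy_davenport hp hsne htne
  -- `(s + t) ∩ sq` is nonempty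
  have hint : ((s + t) ∩ sq).Nonempty := by
    by_contra hempty
    rw [Finset.not_nonempty_iff_eq_empty] at hempty
    have hdisj : Disjoint (s + t) sq := Finset.disjoint_iff_inter_eq_empty.2 hempty
    have hle : (s + t).card + sq.card ≤ p :=
      calc (s + t).card + sq.card = (s + t ∪ sq).card := (Finset.card_union_of_disjoint hdisj).symm
        _ ≤ Fintype.card (ZMod p) := Finset.card_le_univ _
        _ = p := hcard
    have hsqpos : 0 < sq.card :=
      Finset.card_pos.2 ⟨1 * 0 ^ 2, Finset.mem_image_of_mem _ (Finset.mem_univ (0 : ZMod p))⟩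
    rcases le_total p (s.card + t.card - 1) with h | h
    · rw [min_eq_left h] at hCD
      omega
    · rw [min_eq_right h] at hCD
      omega
  obtain ⟨c, hc⟩ := hint
  rw [Finset.mem_inter, Finset.mem_add] at hc
  obtain ⟨⟨x, hx, y, hy, hxy⟩, hcsq⟩ := hc
  rw [hs, Finset.mem_image] at hx
  rw [ht, Finset.mem_image] at hy
  rw [hsq, Finset.mem_image] at hcsq
  obtain ⟨u, hu, rfl⟩ := hx
  obtain ⟨v, hv, rfl⟩ := hy
  obtain ⟨w, -, rfl⟩ := hcsq
  rw [hS₀, Finset.mem_erase] at hu hv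
  exact ⟨u, v, w, hu.1, hv.1, by rw [hxy, one_mul]⟩

end Conic

/-! ### The general case of (11) -/

section NumberField

variable {K : Type} [Field K] [NumberField K]
variable (hreal : ∃ w : InfinitePlace K, w.IsReal) (hunit : ∃ v : (𝓞 K)ˣ, ∀ n : ℕ, n ≠ 0 → v ^ n ≠ 1)
include hreal hunit

omit [NumberField K] hreal hunit in
/-- `[b over u] = 1` for a unit `u ≡ 1 (mod z⁴)`, `z ∈ 𝔮`, `b ∈ 𝔮`: `[b over u] = [0 over u]` by (6) and
`diag(u, u⁻¹) ∈ E(𝔮, A)` (`u = 1 + xy`, `x, y ∈ 𝔮`). [cite: Liehl1981SL2Orders, §3 (11)] -/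
theorem sym_eq_one_of_isUnit {𝔮 : Ideal (𝓞 K)} {z : 𝓞 K} (hz : z ∈ 𝔮) {a b : 𝓞 K}
    (ha : a - 1 ∈ Ideal.span {z * z * (z * z)}) (hu : IsUnit a) (hb : b ∈ 𝔮) : sym 𝔮 a b = 1 := by
  obtain ⟨u, rfl⟩ := hu
  have hzz : z * z ∈ 𝔮 := 𝔮.mul_mem_left _ hz
  obtain ⟨s, hs⟩ := Ideal.mem_span_singleton'.1 ha
  have ha𝔮 : (u : 𝓞 K) - 1 ∈ 𝔮 := by rw [← hs]; exact 𝔮.mul_mem_left _ (𝔮.mul_mem_left _ hzz)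
  have hub : IsCoprime (u : 𝓞 K) b := ⟨↑u⁻¹, 0, by simp⟩
  -- `[b over u] = [0 over u]`
  have h1 : sym 𝔮 (u : 𝓞 K) b = sym 𝔮 u 0 := by
    have h := sym_add_mul_right ha𝔮 hb hub (𝔮.neg_mem (𝔮.mul_mem_right (↑u⁻¹ : 𝓞 K) hb))
    rw [show b + -(b * ↑u⁻¹) * (u : 𝓞 K) = 0 by
      rw [neg_mul, Units.inv_mul_cancel_right, add_neg_cancel]] at h
    exact h.symm
  -- `diag(u, u⁻¹) ∈ E(𝔮, A)` with first row `(u, 0)`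
  have hu' : (u : 𝓞 K) = 1 + z * z * (s * (z * z)) := by linear_combination -hs
  obtain ⟨k00, k01, -, -⟩ := diag_four_apply (z * z) (s * (z * z)) u hu'
  have hE : e12 (z * z) * e21 (s * (z * z)) * e12 (-(z * z * ↑u⁻¹)) * e21 (-(s * (z * z) * u)) ∈
      relE 𝔮 ⊤ :=
    mul_mem (mul_mem (mul_mem (e12_mem_relE hzz) (e21_mem_relE Submodule.mem_top))
      (e12_mem_relE (𝔮.neg_mem (𝔮.mul_mem_right _ hzz)))) (e21_mem_relE Submodule.mem_top)
  rw [h1, sym_eq_mk ⟨_, relE_le_relG _ _ hE⟩ k00 k01]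
  exact mk_eq_one_of_mem_relE _ hE

omit [NumberField K] hreal hunit in
/-- `[b over a] = 1` if `b` is a unit (`(a, b) ∼ (1, b)` by (6)). [cite: Liehl1981SL2Orders, §3 (6)] -/
theorem sym_eq_one_of_isUnit_right {𝔮 : Ideal (𝓞 K)} {a b : 𝓞 K} (ha : a - 1 ∈ 𝔮) (hb : b ∈ 𝔮)
    (hu : IsUnit b) : sym 𝔮 a b = 1 := by
  obtain ⟨u, rfl⟩ := hu
  have hau : IsCoprime a (u : 𝓞 K) := ⟨0, ↑u⁻¹, by simp⟩
  have h := sym_add_mul_left ha hb hau ((1 - a) * ↑u⁻¹)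
  rw [show a + (1 - a) * ↑u⁻¹ * (u : 𝓞 K) = 1 by rw [mul_assoc, Units.inv_mul]; ring,
    sym_one_left hb] at h
  exact h.symm

/-- **Case 3 of (11) from a solution of the conic modulo a prime `a`**: if `(a) = P` is a maximal ideal
with residue field of prime order `p ≥ 5`, `(a, b₁)`, `(a, b₂)` rows of `G(z²A, z²A)`, then
`[b₁ over a][b₂ over a] = [b₁b₂ over a]`. [cite: Liehl1981SL2Orders, §3 (11) (Case 3, general case)] -/
theorem sym_mul_sym_of_prime {𝔮 : Ideal (𝓞 K)} {z : 𝓞 K} (hz : z ∈ 𝔮) (hz0 : z ≠ 0)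
    {a b₁ b₂ : 𝓞 K} (ha : a - 1 ∈ Ideal.span {z * z * (z * z)}) (hb₁ : b₁ ∈ Ideal.span {z * z})
    (hb₂ : b₂ ∈ Ideal.span {z * z}) (hab₁ : IsCoprime a b₁) (hab₂ : IsCoprime a b₂)
    [(Ideal.span {a}).IsMaximal] {p : ℕ} (hp : p.Prime) (h5 : 5 ≤ p)
    [Fintype (𝓞 K ⧸ Ideal.span {a})] (hcard : Fintype.card (𝓞 K ⧸ Ideal.span {a}) = p) :
    sym 𝔮 a b₁ * sym 𝔮 a b₂ = sym 𝔮 a (b₁ * b₂) := by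
  classical
  haveI : Fact p.Prime := ⟨hp⟩
  set e : ZMod p ≃+* 𝓞 K ⧸ Ideal.span {a} := ZMod.ringEquivOfPrime (𝓞 K ⧸ Ideal.span {a}) hp hcard
    with he
  have hPtop : Ideal.span {a} ≠ ⊤ := Ideal.IsMaximal.ne_top inferInstance
  have hau : ¬ IsUnit a := fun h ↦ hPtop (by rwa [Ideal.span_singleton_eq_top])
  -- `b ≢ 0 (mod a)` for `(a, b) = 1`, and conversely `(a, x) = 1` for `x ≢ 0`
  have hne : ∀ {b : 𝓞 K}, IsCoprime a b → Ideal.Quotient.mk (Ideal.span {a}) b ≠ 0 := by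
    intro b hab h
    rw [Ideal.Quotient.eq_zero_iff_mem, Ideal.mem_span_singleton] at h
    exact hau (hab.isUnit_of_dvd' dvd_rfl h)
  have hcop : ∀ {x : 𝓞 K}, Ideal.Quotient.mk (Ideal.span {a}) x ≠ 0 → IsCoprime a x := by
    intro x hx
    have hxP : x ∉ Ideal.span {a} := fun h ↦ hx (by rwa [Ideal.Quotient.eq_zero_iff_mem])
    obtain ⟨y, i, hi, hyi⟩ := Ideal.IsMaximal.exists_inv inferInstance hxP
    rw [Ideal.mem_span_singleton'] at hi
    obtain ⟨c, rfl⟩ := hi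
    exact ⟨c, y, by linear_combination hyi⟩
  -- the conic over `𝔽_p`
  set b₁' : ZMod p := e.symm (Ideal.Quotient.mk (Ideal.span {a}) b₁) with hb₁'
  set b₂' : ZMod p := e.symm (Ideal.Quotient.mk (Ideal.span {a}) b₂) with hb₂'
  have hb₁'e : e b₁' = Ideal.Quotient.mk (Ideal.span {a}) b₁ := e.apply_symm_apply _
  have hb₂'e : e b₂' = Ideal.Quotient.mk (Ideal.span {a}) b₂ := e.apply_symm_apply _
  have hb₁'0 : b₁' ≠ 0 := fun h ↦ hne hab₁ (by rw [← hb₁'e, h, map_zero])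
  have hb₂'0 : b₂' ≠ 0 := fun h ↦ hne hab₂ (by rw [← hb₂'e, h, map_zero])
  obtain ⟨u', v', w', hu', hv', hconic⟩ := exists_conic_sol hp h5 hb₁'0 hb₂'0
  set x' : ZMod p := u' * (b₂' * v')⁻¹ with hx'
  set y' : ZMod p := w' * u'⁻¹ with hy'
  have E1 : x' * (b₂' * v') = u' := by rw [hx', inv_mul_cancel_right₀ (mul_ne_zero hb₂'0 hv')]
  have E2 : y' * u' = w' := by rw [hy', inv_mul_cancel_right₀ hu']
  have hx'0 : x' ≠ 0 := by
    rw [hx']; exact mul_ne_zero hu' (inv_ne_zero (mul_ne_zero hb₂'0 hv'))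
  have key : b₁' * b₂' * x' ^ 2 - y' ^ 2 * x' ^ 2 * b₂' + 1 = 0 := by
    have h : (b₁' * b₂' * x' ^ 2 - y' ^ 2 * x' ^ 2 * b₂' + 1) * (b₂' * v' ^ 2) = 0 := by
      linear_combination ((b₁' - y' ^ 2) * (b₂' * x' * v' + u')) * E1 + hconic -
        (y' * u' + w') * E2
    rcases mul_eq_zero.1 h with h | h
    · exact h
    · exact absurd h (mul_ne_zero hb₂'0 (pow_ne_zero 2 hv'))
  -- lift `x', y'` to `x₁, y₁ ∈ 𝓞 K`, then move them into `zA` without changing them mod `a`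
  obtain ⟨x₁, hx₁⟩ := Ideal.Quotient.mk_surjective (I := Ideal.span {a}) (e x')
  obtain ⟨y₁, hy₁⟩ := Ideal.Quotient.mk_surjective (I := Ideal.span {a}) (e y')
  have haz : IsCoprime a z := by
    obtain ⟨s, hs⟩ := Ideal.mem_span_singleton'.1 ha
    exact ⟨1, -(s * z * (z * z)), by linear_combination -hs⟩
  obtain ⟨p', q', hpq⟩ := haz
  set x₀ := x₁ * (q' * z) with hx₀
  set y₀ := y₁ * (q' * z) with hy₀
  have hqz : Ideal.Quotient.mk (Ideal.span {a}) (q' * z) = 1 := by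
    rw [show q' * z = 1 - p' * a by linear_combination hpq, map_sub, map_one, sub_eq_self,
      Ideal.Quotient.eq_zero_iff_mem]
    exact Ideal.mul_mem_left _ _ (Ideal.mem_span_singleton_self a)
  have hmx₀ : Ideal.Quotient.mk (Ideal.span {a}) x₀ = e x' := by
    rw [hx₀, map_mul, hqz, mul_one]; exact hx₁
  have hmy₀ : Ideal.Quotient.mk (Ideal.span {a}) y₀ = e y' := by
    rw [hy₀, map_mul, hqz, mul_one]; exact hy₁
  have hrel : b₁ * b₂ * x₀ * x₀ - y₀ * y₀ * x₀ * x₀ * b₂ + 1 ∈ Ideal.span {a} := by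
    rw [← Ideal.Quotient.eq_zero_iff_mem]
    have : Ideal.Quotient.mk (Ideal.span {a}) (b₁ * b₂ * x₀ * x₀ - y₀ * y₀ * x₀ * x₀ * b₂ + 1) =
        e (b₁' * b₂' * x' ^ 2 - y' ^ 2 * x' ^ 2 * b₂' + 1) := by
      simp only [map_add, map_sub, map_mul, map_pow, map_one, hmx₀, hmy₀, hb₁'e, hb₂'e]
      ring
    rw [this, key, map_zero]
  have hax₀ : IsCoprime a x₀ := by
    refine (hcop fun h ↦ hx'0 ?_).mul_right ⟨p', 1, by linear_combination hpq⟩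
    exact e.injective (by rw [map_zero, ← hx₁]; exact h)
  refine sym_case3 hreal hunit hz hz0 ha hb₁ hb₂ hab₁ hab₂ ?_ ?_ hrel hax₀
  · exact Ideal.mem_span_singleton'.2 ⟨x₁ * q', by rw [hx₀]; ring⟩
  · exact Ideal.mem_span_singleton'.2 ⟨y₁ * q', by rw [hy₀]; ring⟩

/-- **Liehl (11)** for the pair `(𝔮, A)`, `A = 𝓞 K`: for `0 ≠ z ∈ 𝔮` and `(a, b₁)`, `(a, b₂)` first rows
of matrices in `G(z²A, z²A)` (i.e. `a - 1 ∈ z⁴A`, `bᵢ ∈ z²A`, `(a, bᵢ) = 1`):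
`[b₁ over a][b₂ over a] = [b₁b₂ over a]`. [cite: Liehl1981SL2Orders, §3 (11)] -/
theorem sym_mul_sym {𝔮 : Ideal (𝓞 K)} {z : 𝓞 K} (hz : z ∈ 𝔮) (hz0 : z ≠ 0) {a b₁ b₂ : 𝓞 K}
    (ha : a - 1 ∈ Ideal.span {z * z * (z * z)}) (hb₁ : b₁ ∈ Ideal.span {z * z})
    (hb₂ : b₂ ∈ Ideal.span {z * z}) (hab₁ : IsCoprime a b₁) (hab₂ : IsCoprime a b₂) :
    sym 𝔮 a b₁ * sym 𝔮 a b₂ = sym 𝔮 a (b₁ * b₂) := by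
  classical
  have hzz : z * z ∈ 𝔮 := 𝔮.mul_mem_left _ hz
  have hI𝔮 : Ideal.span {z * z} ≤ 𝔮 := (Ideal.span_singleton_le_iff_mem _).2 hzz
  have hz4 : Ideal.span {z * z * (z * z)} ≤ 𝔮 :=
    (Ideal.span_singleton_le_iff_mem _).2 (𝔮.mul_mem_left _ hzz)
  have ha𝔮 : a - 1 ∈ 𝔮 := hz4 ha
  -- `a` a unit (covers `a = 1` and `b₁b₂ = 0`)
  by_cases hau : IsUnit a
  · rw [sym_eq_one_of_isUnit hz ha hau (hI𝔮 hb₁), sym_eq_one_of_isUnit hz ha hau (hI𝔮 hb₂),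
      sym_eq_one_of_isUnit hz ha hau (𝔮.mul_mem_left _ (hI𝔮 hb₂)), one_mul]
  have hb0 : b₁ * b₂ ≠ 0 := by
    refine mul_ne_zero (fun h ↦ hau ?_) (fun h ↦ hau ?_)
    · rw [h, isCoprime_zero_right] at hab₁; exact hab₁
    · rw [h, isCoprime_zero_right] at hab₂; exact hab₂
  -- `a = 0`: `b₁, b₂` are units
  by_cases ha0 : a = 0
  · rw [ha0] at hab₁ hab₂ ha𝔮 ⊢
    rw [isCoprime_zero_left] at hab₁ hab₂
    rw [sym_eq_one_of_isUnit_right ha𝔮 (hI𝔮 hb₁) hab₁,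
      sym_eq_one_of_isUnit_right ha𝔮 (hI𝔮 hb₂) hab₂,
      sym_eq_one_of_isUnit_right ha𝔮 (𝔮.mul_mem_left _ (hI𝔮 hb₂)) (hab₁.mul hab₂), one_mul]
  have ha1 : a - 1 ≠ 0 := fun h ↦ hau (by rw [sub_eq_zero.1 h]; exact isUnit_one)
  -- a prime `π ≡ a (mod (a - 1)b₁b₂)` of prime norm `p ∉ {2, 3}`
  set 𝔪 : Ideal (𝓞 K) := Ideal.span {(a - 1) * (b₁ * b₂)} with h𝔪
  have h𝔪0 : 𝔪 ≠ ⊥ := by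
    rw [h𝔪, Ne, Ideal.span_singleton_eq_bot]; exact mul_ne_zero ha1 hb0
  have hx𝔪 : IsCoprime (Ideal.span {a}) 𝔪 := by
    rw [h𝔪, Ideal.isCoprime_span_singleton_iff]
    exact (show IsCoprime a (a - 1) from ⟨1, -1, by ring⟩).mul_right (hab₁.mul_right hab₂)
  set S : Set (HeightOneSpectrum (𝓞 K)) := {v | v.asIdeal ∣ Ideal.span {(6 : 𝓞 K)}} with hS
  have hS6 : Ideal.span {(6 : 𝓞 K)} ≠ ⊥ := by
    rw [Ne, Ideal.span_singleton_eq_bot]; exact_mod_cast (by norm_num : (6 : ℕ) ≠ 0)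
  have hSfin : S.Finite := Ideal.finite_factors hS6
  obtain ⟨v, hvS, -, hprime, π, hπ, hπa, -⟩ := SerreSL2.exists_prime_mul_eq_span_singleton h𝔪0
    (𝔟 := ⊤) top_ne_bot (by rw [← Ideal.one_eq_top]; exact isCoprime_one_left) ha0 hx𝔪 S hSfin
  rw [Ideal.mul_top] at hπ
  -- `hπ : v.asIdeal = span {π}`
  set p : ℕ := Ideal.absNorm v.asIdeal with hpdef
  have hv0 : v.asIdeal ≠ ⊥ := v.ne_bot
  haveI hmax : (Ideal.span {π}).IsMaximal := hπ ▸ v.isMaximal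
  haveI : Finite (𝓞 K ⧸ Ideal.span {π}) := Ideal.finiteQuotientOfFreeOfNeBot _ (hπ ▸ hv0)
  letI : Fintype (𝓞 K ⧸ Ideal.span {π}) := Fintype.ofFinite _
  have hcard : Fintype.card (𝓞 K ⧸ Ideal.span {π}) = p := by
    rw [hpdef, hπ, Ideal.absNorm_apply, Submodule.cardQuot_apply, Nat.card_eq_fintype_card]
  have h5 : 5 ≤ p := by
    refine hprime.five_le_of_ne_two_of_ne_three (fun h2 ↦ hvS ?_) (fun h3 ↦ hvS ?_)
    · have hm : ((2 : ℕ) : 𝓞 K) ∈ v.asIdeal := h2 ▸ Ideal.absNorm_mem v.asIdeal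
      show v.asIdeal ∣ Ideal.span {6}
      rw [Ideal.dvd_iff_le, Ideal.span_singleton_le_iff_mem,
        show (6 : 𝓞 K) = 3 * (2 : ℕ) by norm_num]
      exact v.asIdeal.mul_mem_left _ hm
    · have hm : ((3 : ℕ) : 𝓞 K) ∈ v.asIdeal := h3 ▸ Ideal.absNorm_mem v.asIdeal
      show v.asIdeal ∣ Ideal.span {6}
      rw [Ideal.dvd_iff_le, Ideal.span_singleton_le_iff_mem,
        show (6 : 𝓞 K) = 2 * (3 : ℕ) by norm_num]
      exact v.asIdeal.mul_mem_left _ hm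
  -- `π = a + m(a-1)b₁b₂`
  obtain ⟨m, hm⟩ := Ideal.mem_span_singleton'.1 hπa
  have hπeq : π = a + m * (a - 1) * (b₁ * b₂) := by linear_combination -hm
  have hπ1 : π - 1 ∈ Ideal.span {z * z * (z * z)} := by
    rw [show π - 1 = (a - 1) + m * (b₁ * b₂) * (a - 1) by rw [hπeq]; ring]
    exact (Ideal.span _).add_mem ha (Ideal.mul_mem_left _ _ ha)
  have hπb₁ : IsCoprime π b₁ := by
    rw [hπeq, show a + m * (a - 1) * (b₁ * b₂) = a + b₁ * (m * (a - 1) * b₂) by ring]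
    exact hab₁.add_mul_left_left _
  have hπb₂ : IsCoprime π b₂ := by
    rw [hπeq, show a + m * (a - 1) * (b₁ * b₂) = a + b₂ * (m * (a - 1) * b₁) by ring]
    exact hab₂.add_mul_left_left _
  have key := sym_mul_sym_of_prime hreal hunit hz hz0 hπ1 hb₁ hb₂ hπb₁ hπb₂ hprime h5 hcard
  -- back to `a` by (6)
  rw [hπeq, show a + m * (a - 1) * (b₁ * b₂) = a + (m * (a - 1) * b₂) * b₁ by ring,
    sym_add_mul_left ha𝔮 (hI𝔮 hb₁) hab₁,
    show a + m * (a - 1) * b₂ * b₁ = a + (m * (a - 1) * b₁) * b₂ by ring,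
    sym_add_mul_left ha𝔮 (hI𝔮 hb₂) hab₂,
    show a + m * (a - 1) * b₁ * b₂ = a + (m * (a - 1)) * (b₁ * b₂) by ring,
    sym_add_mul_left ha𝔮 (𝔮.mul_mem_left _ (hI𝔮 hb₂)) (hab₁.mul_right hab₂)] at key
  exact key

end NumberField

end SL2Rel

end Literature.NumberTheory.Automorphic
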